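import Summits.Ventures.CertifiedManyBodySolver.Certificates.HubbardSquare_cellword_Kit
import HarnessLib

/-!
# Ventures/CertifiedManyBodySolver — Certificates/HubbardSquare_cellword_KitSheet.lean (hubbard-box-eng-2 g4, cell hubbard-fast)

HONEST FRAMING: transport bookkeeping of certified ground-state-energy bounds; not a superconductivity verdict; not a pairing
bound; no number is certified in this file — it holds the GENERIC slab lemmas for n-SHEETS (density-affine floors
`A + B·m ≤ e₀(1,t′,U,m)` for every `0 ≤ m < 2` at a census node, as produced from a node certificate's dual by Lagrangian
right-hand-side sensitivity — hubbard-box-eng-1's «n-sheets for free», DERIVED-NSHEETS tables) used by the census-CELL kernel words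
(`HubbardSquare_cellword_*.lean`) next to `cell_node_floor` (the two extended secants of `HubbardSquare_cellword_Kit`):
* `cell_node_floor_sheet` — a sheet gives the slab-uniform floor `min (A + B n₁) (A + B n₂)` on `[n₁, n₂]` (affine ⇒ endpoint minimum);
* `cell_node_floor_sheet_max` — the better of the sheet floor and any other slab-uniform floor (e.g. `cell_node_floor`'s) is a slab floor;
* `cell_node_floor_affine` — the sheet restated as an `n`-AFFINE floor on the slab (the shape of affine / tangent-form cell words).
-/

noncomputable section

namespace Summit.Ventures.CertifiedManyBodySolver.Certificates

open Matrix Finset Filter Topology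
open Literature.MathematicalPhysics.QuantumLattice
open Literature.MathematicalPhysics.QuantumLattice.ThermodynamicLimit
open Literature.Probability.LatticeModels
open scoped ComplexOrder ComplexConjugate Topology BigOperators

/-- **Slab floor from an n-sheet.** A density-affine floor `A + B·m ≤ e(t′,U,m)` for all `0 ≤ m < 2` gives, on every slab
`[n₁, n₂] ⊂ [0, 2)`, the uniform floor `min (A + B n₁) (A + B n₂)` (an affine function attains its minimum over an interval at an
endpoint). [cite: Ruelle1969, §3.3] -/
theorem cell_node_floor_sheet {t' U A B n₁ n₂ : ℝ} (hn₁ : 0 ≤ n₁) (hn₂ : n₂ < 2)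
    (hS : ∀ m : ℝ, 0 ≤ m → m < 2 → A + B * m ≤ energyDensityTT' 1 t' U m)
    {n : ℝ} (hn : n ∈ Set.Icc n₁ n₂) :
    min (A + B * n₁) (A + B * n₂) ≤ energyDensityTT' 1 t' U n := by
  have h := hS n (hn₁.trans hn.1) (lt_of_le_of_lt hn.2 hn₂)
  rcases le_total 0 B with hB | hB
  · have h1 : A + B * n₁ ≤ A + B * n := by nlinarith [hn.1]
    exact (min_le_left _ _).trans (h1.trans h)
  · have h2 : A + B * n₂ ≤ A + B * n := by nlinarith [hn.2]
    exact (min_le_right _ _).trans (h2.trans h)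

/-- **Best of two slab floors.** Two slab-uniform floors `F₁`, `F₂` on `[n₁, n₂]` (e.g. the sheet floor and the extended-secant floor of
`cell_node_floor`) give the slab-uniform floor `max F₁ F₂`. [cite: Ruelle1969, §3.3] -/
theorem cell_node_floor_sheet_max {t' U F₁ F₂ n₁ n₂ : ℝ}
    (h₁ : ∀ n ∈ Set.Icc n₁ n₂, F₁ ≤ energyDensityTT' 1 t' U n)
    (h₂ : ∀ n ∈ Set.Icc n₁ n₂, F₂ ≤ energyDensityTT' 1 t' U n) :
    ∀ n ∈ Set.Icc n₁ n₂, max F₁ F₂ ≤ energyDensityTT' 1 t' U n :=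
  fun n hn => max_le (h₁ n hn) (h₂ n hn)

/-- **Affine-in-n floor on a slab** (tangent-form shape): the sheet restricted to `[n₁, n₂] ⊂ [0, 2)`. [cite: Ruelle1969, §3.3] -/
theorem cell_node_floor_affine {t' U A B n₁ n₂ : ℝ} (hn₁ : 0 ≤ n₁) (hn₂ : n₂ < 2)
    (hS : ∀ m : ℝ, 0 ≤ m → m < 2 → A + B * m ≤ energyDensityTT' 1 t' U m) :
    ∀ n ∈ Set.Icc n₁ n₂, A + B * n ≤ energyDensityTT' 1 t' U n :=
  fun n hn => hS n (hn₁.trans hn.1) (lt_of_le_of_lt hn.2 hn₂)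

end Summit.Ventures.CertifiedManyBodySolver.Certificates

end
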